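import Summits.AnomalousDissipation.AnomalousDissipation.Theorems.SolenoidalFractalHomogenisationRealisedQuasiStaticCellLawInPlaneBlock
import Summits.AnomalousDissipation.AnomalousDissipation.Theorems.SolenoidalFractalHomogenisationRealisedQuasiStaticCellLawOutOfPlaneBlock
import Summits.AnomalousDissipation.AnomalousDissipation.Theorems.SolenoidalFractalHomogenisationLadderFunctionalTridiagonal
import HarnessLib

/-!
# K2R `RealisedQuasiStaticCellLaw`, line `floquet-bloch`: ENHANCED decay of the in-plane block of a principal ladder during
# a slot window (helper towards `stub_lowSectorDecay` / `stub_upperSome`; `--supports stmt-AnomalousDissipation-20446`)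

Summits-side helper file (everything proved; no definitions, no named facts). Companion of `…OutOfPlaneDecay`: the
in-plane components `u_J = ⟪p_J, α_N(·)(k₀ + J•K_j)⟫` (`…InPlaneBlock`, links = Leray cosines `s_J = p_J·p_{J+1}`) are
gauged by `μ_j^{-J}` (`Literature.Analysis.ODE.ThreeTermLadder`) and fed into `ladderFunctional_decay_intWindow`:
on a window `[t₀, t₁] ⊆ [0, T]` in slot `j`, with `0, ±1` in the segment `W`, the diagonal hypotheses of the ladder
functional, `|s_J| ≤ 1`, `γ² = s₀² + s₋₁² > 0` and the coupling `g_j ∈ [g_lo, g_hi]`,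
`∑_{J∈W} ‖u_J(t)‖² ≤ (5/3)·exp(-(Λ_j γ² g_lo min(g_lo, g_hi⁻¹)/80)(t - t₀))·∑_{J∈W} ‖u_J(t₀)‖²`, uniformly in `N`
(`inPlane_block_decay`; STUB-PLAN `stub_lowSectorDecay` §3.3/§3.5, in-plane block with `γ_j² ↔ (q̂·m̂_j)²`).
-/

set_option linter.dupNamespace false

noncomputable section

namespace Summit.AnomalousDissipation.AnomalousDissipation.Theorems.SolenoidalFractalHomogenisation.RealisedQuasiStaticCellLaw

open Set MeasureTheory Filter Topology Function Complex Matrix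
open scoped InnerProductSpace ComplexConjugate Matrix
open Literature.Analysis Literature.Analysis.FunctionSpaces Literature.Analysis.FunctionSpaces.Torus
open Literature.Analysis.FluidPDE Literature.Analysis.FluidPDE.LatticeShear
open Literature.Analysis.ODE.ThreeTermLadder

variable {k₀ : ℕ}

/-- **Enhanced decay of the in-plane block of a principal ladder during a slot window** (uniform in `N`). -/
theorem inPlane_block_decay (W : LatticeWord k₀) {n : ℕ} (hn : 0 < n) {κ : ℝ} (hκ : 0 < κ)
    (ℓ : Fin 3 → ℤ) {w₀ : UnitAddTorus (Fin 3) → EuclideanSpace ℝ (Fin 3)}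
    (hw₀ : FunctionSpaces.Torus.MemSobolev 1 (FunctionSpaces.EuclideanSpace.complexify ∘ w₀))
    (hdiv : FunctionSpaces.Torus.IsWeaklyDivFree w₀) (hmean : FunctionSpaces.Torus.HasZeroMean w₀)
    (hsupp : ∀ k : Fin 3 → ℤ, ¬ ((∃ z : Fin 3 → ℤ, k = ℓ + (n:ℤ) • z) ∨ (∃ z : Fin 3 → ℤ, k = -ℓ + (n:ℤ) • z)) →
      UnitAddTorus.mFourierCoeff (FunctionSpaces.EuclideanSpace.complexify ∘ w₀) k = 0)
    {N : ℕ} (hBN : (Finset.univ.biUnion fun j : Fin k₀ =>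
        ({(fun i => (W.phase j).m i * n), -(fun i => (W.phase j).m i * n)} : Finset (Fin 3 → ℤ))) ⊆ freqBall N)
    {T t₀ t₁ : ℝ} (ht₀ : 0 ≤ t₀) (ht₁T : t₁ ≤ T) (j : Fin k₀)
    (hwin : ∀ t ∈ Icc t₀ t₁, Int.fract (t / W.period) * W.period ∈ Icc (W.start j) (W.start j + (W.phase j).τ))
    (k0 : Fin 3 → ℤ) (hk : ∀ J : ℤ, k0 + J • (fun i => (W.phase j).m i * (n : ℤ)) ∈ freqBall N →
      k0 + J • (fun i => (W.phase j).m i * (n : ℤ)) ≠ 0)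
    {ζr : Fin 3 → ℝ} (hζ1 : ζr ⬝ᵥ ζr = 1) (hζ0 : ζr ⬝ᵥ (fun i => ((k0 i : ℤ) : ℝ)) = 0)
    (hζK : ζr ⬝ᵥ (fun i => (((fun i => (W.phase j).m i * (n : ℤ)) i : ℤ) : ℝ)) = 0)
    {p : ℤ → Fin 3 → ℝ}
    (hp : ∀ J : ℤ, p J = (Real.sqrt ((fun i => (((k0 + J • (fun i => (W.phase j).m i * (n : ℤ))) i : ℤ) : ℝ)) ⬝ᵥ
        (fun i => (((k0 + J • (fun i => (W.phase j).m i * (n : ℤ))) i : ℤ) : ℝ))))⁻¹ •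
        (fun i => (((k0 + J • (fun i => (W.phase j).m i * (n : ℤ))) i : ℤ) : ℝ)) ⨯₃ ζr)
    {Wset : Finset ℤ} (hW : ∀ J : ℤ, J ∈ Wset ↔ k0 + J • (fun i => (W.phase j).m i * (n : ℤ)) ∈ freqBall N)
    (h0 : (0 : ℤ) ∈ Wset) (h1 : (1 : ℤ) ∈ Wset) (hm1 : (-1 : ℤ) ∈ Wset)
    (hs : ∀ J ∈ Wset, |p J ⬝ᵥ p (J + 1)| ≤ 1) (hγpos : 0 < (p 0 ⬝ᵥ p 1) ^ 2 + (p (-1) ⬝ᵥ p 0) ^ 2)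
    (hd0 : freqNormSq k0 / freqNormSq (fun i => (W.phase j).m i * (n : ℤ)) ≤ 1)
    (hd : ∀ J ∈ Wset, J ≠ 0 →
      1 / 2 ≤ freqNormSq (k0 + J • (fun i => (W.phase j).m i * (n : ℤ))) / freqNormSq (fun i => (W.phase j).m i * (n : ℤ)))
    (hd1 : freqNormSq (k0 + (1 : ℤ) • (fun i => (W.phase j).m i * (n : ℤ))) /
      freqNormSq (fun i => (W.phase j).m i * (n : ℤ)) ≤ 2)
    (hdm1 : freqNormSq (k0 + (-1 : ℤ) • (fun i => (W.phase j).m i * (n : ℤ))) /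
      freqNormSq (fun i => (W.phase j).m i * (n : ℤ)) ≤ 2)
    {g_lo g_hi : ℝ} (hglo : 0 < g_lo) (hghi : g_lo ≤ g_hi)
    (hg : ∀ t ∈ Ioo t₀ t₁,
      g_lo ≤ 2 * Real.pi * (∑ i, (W.phase j).e i * (k0 i : ℝ)) *
          ‖Complex.exp ((W.phase j).φ * Complex.I) *
            (1 / (2 * ((2 * Real.pi * ‖latticeVec (W.phase j).m‖ : ℝ) : ℂ) * Complex.I))‖ *
          ((1 / (n : ℝ)) * LatticeWord.trapezoid (W.start j) (W.phase j).τ W.ramp (Int.fract (t / W.period) * W.period)) /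
        (κ * (4 * Real.pi ^ 2 * freqNormSq (fun i => (W.phase j).m i * (n : ℤ)))) ∧
      2 * Real.pi * (∑ i, (W.phase j).e i * (k0 i : ℝ)) *
          ‖Complex.exp ((W.phase j).φ * Complex.I) *
            (1 / (2 * ((2 * Real.pi * ‖latticeVec (W.phase j).m‖ : ℝ) : ℂ) * Complex.I))‖ *
          ((1 / (n : ℝ)) * LatticeWord.trapezoid (W.start j) (W.phase j).τ W.ramp (Int.fract (t / W.period) * W.period)) /
        (κ * (4 * Real.pi ^ 2 * freqNormSq (fun i => (W.phase j).m i * (n : ℤ)))) ≤ g_hi) :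
    ∀ t ∈ Icc t₀ t₁,
      ∑ J ∈ Wset, ‖inner ℂ (WithLp.toLp 2 (Complex.ofReal ∘ p J) : EuclideanSpace ℂ (Fin 3))
          ((pvSetup_cell W hn hκ.le ℓ hw₀ hdiv hmean hsupp).galerkinCoeffAt N t
            (k0 + J • (fun i => (W.phase j).m i * (n : ℤ))))‖ ^ 2 ≤
        5 / 3 * Real.exp (-(κ * (4 * Real.pi ^ 2 * freqNormSq (fun i => (W.phase j).m i * (n : ℤ))) *
            ((p 0 ⬝ᵥ p 1) ^ 2 + (p (-1) ⬝ᵥ p 0) ^ 2) * g_lo * min g_lo g_hi⁻¹ / 80) * (t - t₀)) *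
          ∑ J ∈ Wset, ‖inner ℂ (WithLp.toLp 2 (Complex.ofReal ∘ p J) : EuclideanSpace ℂ (Fin 3))
            ((pvSetup_cell W hn hκ.le ℓ hw₀ hdiv hmean hsupp).galerkinCoeffAt N t₀
              (k0 + J • (fun i => (W.phase j).m i * (n : ℤ))))‖ ^ 2 := by
  intro t ht
  set hPV := pvSetup_cell W hn hκ.le ℓ hw₀ hdiv hmean hsupp with hPVdef
  set K : Fin 3 → ℤ := fun i => (W.phase j).m i * (n : ℤ) with hK
  set A : ℂ := Complex.exp ((W.phase j).φ * Complex.I) *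
    (1 / (2 * ((2 * Real.pi * ‖latticeVec (W.phase j).m‖ : ℝ) : ℂ) * Complex.I)) with hA
  have hA0 : A ≠ 0 := layerAmp_ne_zero (W.phase j)
  set pc : ℤ → EuclideanSpace ℂ (Fin 3) := fun J => WithLp.toLp 2 (Complex.ofReal ∘ p J) with hpc
  -- the raw in-plane components and the gauged ones
  set u : ℝ → ℤ → ℂ := fun τ J => inner ℂ (pc J) (hPV.galerkinCoeffAt N τ (k0 + J • K)) with hu
  set v : ℝ → ℤ → ℂ := fun τ J => (Complex.I * A / (‖A‖ : ℂ)) ^ (-J) * u τ J with hv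
  set s : ℤ → ℝ := fun J => p J ⬝ᵥ p (J + 1) with hsdef
  set g : ℝ → ℝ := fun τ => 2 * Real.pi * (∑ i, (W.phase j).e i * (k0 i : ℝ)) * ‖A‖ *
      ((1 / (n : ℝ)) * LatticeWord.trapezoid (W.start j) (W.phase j).τ W.ramp (Int.fract (τ / W.period) * W.period)) /
    (κ * (4 * Real.pi ^ 2 * freqNormSq K)) with hgdef
  set d : ℤ → ℝ := fun J => freqNormSq (k0 + J • K) / freqNormSq K with hddef
  have hK0 : K ≠ 0 := cellFreq_ne_zero (W.phase j) hn
  have hKpos : 0 < freqNormSq K := by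
    obtain ⟨i, hi⟩ : ∃ i, K i ≠ 0 := by
      by_contra h
      push Not at h
      exact hK0 (funext h)
    have hi' : (K i : ℝ) ≠ 0 := by exact_mod_cast hi
    unfold freqNormSq
    exact lt_of_lt_of_le (by positivity) (Finset.single_le_sum (fun l _ => sq_nonneg ((K l : ℝ))) (Finset.mem_univ i))
  have hΛ : 0 < κ * (4 * Real.pi ^ 2 * freqNormSq K) := by positivity
  -- vanishing off the segment
  have hvsupp : ∀ τ ∈ Icc t₀ t₁, ∀ J, J ∉ Wset → v τ J = 0 := by
    intro τ _ J hJ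
    have hnot : k0 + J • K ∉ freqBall N := fun h => hJ ((hW J).2 h)
    simp only [hv, hu]
    rw [Torus.PVSetup.galerkinCoeffAt, coeffExt_of_not_mem _ hnot, inner_zero_right, mul_zero]
  -- the coupling scalar is real
  have hθ : ∑ i, (EuclideanSpace.complexify (W.phase j).e) i * (k0 i : ℂ) =
      ((∑ i, (W.phase j).e i * (k0 i : ℝ) : ℝ) : ℂ) := by
    push_cast
    refine Finset.sum_congr rfl fun i _ => ?_
    rw [EuclideanSpace.complexify_apply]
  -- the gauged ladder on the window, in the consumer form
  have hderiv : ∀ τ ∈ Icc t₀ t₁, ∀ J ∈ Wset, HasDerivWithinAt (fun τ' => v τ' J)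
      (-((κ * (4 * Real.pi ^ 2 * freqNormSq K) : ℝ) : ℂ) * ((d J : ℂ) * v τ J) -
        (g τ : ℂ) * ((κ * (4 * Real.pi ^ 2 * freqNormSq K) : ℝ) : ℂ) *
          ((s (J - 1) : ℂ) * v τ (J - 1) - (s J : ℂ) * v τ (J + 1))) (Icc t₀ t₁) τ := by
    intro τ hτ J hJ
    have hτT : τ ∈ Icc 0 T := ⟨ht₀.trans hτ.1, hτ.2.trans ht₁T⟩
    have h1 := hasDerivWithinAt_inPlane_slot W hn hκ.le ℓ hw₀ hdiv hmean hsupp hBN hτT j (hwin τ hτ) k0 hk hζ1 hζ0 hζK hp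
      J ((hW J).1 hJ)
    -- to the gauge input shape
    set c : ℝ := (1 / (n : ℝ)) * LatticeWord.trapezoid (W.start j) (W.phase j).τ W.ramp
      (Int.fract (τ / W.period) * W.period) with hc
    set r : ℂ := ((2 * Real.pi * (∑ i, (W.phase j).e i * (k0 i : ℝ)) * c : ℝ) : ℂ) with hr
    have h2 : HasDerivWithinAt (fun τ' => u τ' J)
        (-(((κ * (4 * Real.pi ^ 2 * freqNormSq (k0 + J • K))) : ℝ) : ℂ) * u τ J -
          (r * Complex.I) * (A * (((p J ⬝ᵥ p (J - 1) : ℝ) : ℂ) * u τ (J - 1)) +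
            conj A * (((p J ⬝ᵥ p (J + 1) : ℝ) : ℂ) * u τ (J + 1)))) (Icc 0 T) τ := by
      refine h1.congr_deriv ?_
      rw [hθ, layerAmp_conj (W.phase j)]
      simp only [hu, hpc, hA, hr, hK]
      push_cast
      ring
    have h3 := (h2.const_mul ((Complex.I * A / (‖A‖ : ℂ)) ^ (-J))).mono (Icc_subset_Icc ht₀ ht₁T)
    refine h3.congr_deriv ?_
    rw [gauge_rhs hA0]
    have hKc : ((freqNormSq K : ℝ) : ℂ) ≠ 0 := by exact_mod_cast hKpos.ne'
    have hκc : ((κ : ℝ) : ℂ) ≠ 0 := by exact_mod_cast hκ.ne'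
    have hπc : ((Real.pi : ℝ) : ℂ) ≠ 0 := by exact_mod_cast Real.pi_pos.ne'
    have hs1 : s (J - 1) = p J ⬝ᵥ p (J - 1) := by
      simp only [hsdef, sub_add_cancel]; exact dotProduct_comm _ _
    have hs2 : s J = p J ⬝ᵥ p (J + 1) := rfl
    rw [hs1, hs2]
    simp only [hv, hgdef, hddef, hr, hc]
    generalize (Complex.I * A / (‖A‖ : ℂ)) ^ (-J) = μ₁
    generalize (Complex.I * A / (‖A‖ : ℂ)) ^ (-(J - 1)) = μ₂
    generalize (Complex.I * A / (‖A‖ : ℂ)) ^ (-(J + 1)) = μ₃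
    generalize (‖A‖ : ℝ) = nA
    push_cast
    field_simp
  have hmain := ladderFunctional_decay_intWindow Wset h0 h1 hm1 d s (κ * (4 * Real.pi ^ 2 * freqNormSq K)) g_lo g_hi
    t₀ t₁ g v (fun J hJ => hs J hJ)
    (by simpa [hsdef, dotProduct_comm (p 0) (p (-1))] using hγpos)
    (div_nonneg (freqNormSq_nonneg _) hKpos.le) (by simpa [hddef] using hd0)
    (fun J hJ hJ0 => by simpa [hddef] using hd J hJ hJ0) (by simpa [hddef] using hd1) (by simpa [hddef] using hdm1)
    hΛ hglo hghi (fun τ hτ => hg τ hτ) hvsupp hderiv t ht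
  -- remove the gauge from the energies
  have hE : ∀ τ, ∑ J ∈ Wset, ‖v τ J‖ ^ 2 = ∑ J ∈ Wset, ‖u τ J‖ ^ 2 := by
    intro τ
    refine Finset.sum_congr rfl fun J _ => ?_
    simp only [hv]
    rw [norm_gauge_zpow_mul hA0]
  rw [hE t, hE t₀] at hmain
  have e2 : s 0 ^ 2 + s (-1) ^ 2 = (p 0 ⬝ᵥ p 1) ^ 2 + (p (-1) ⬝ᵥ p 0) ^ 2 := by
    simp only [hsdef, zero_add, neg_add_cancel]
  rw [e2] at hmain
  convert hmain using 3

end Summit.AnomalousDissipation.AnomalousDissipation.Theorems.SolenoidalFractalHomogenisation.RealisedQuasiStaticCellLaw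

end
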